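import Literature.Barriers.ValiantsHypothesis.BILPS19MembershipHardness
import Literature.Computability.Complexity.ThreeColouringMachine
import Literature.Computability.Complexity.ChromaticNP
import Literature.Computability.Complexity.CodeFPStrings
import HarnessLib

/-!
# Bläser–Ikenmeyer–Lysikov–Pandey–Schreyer 2019, Thm 33: `HQuad_{{0,1,−1},F}` is NP-hard — proofs

Sibling proof file of `BILPS19MembershipHardness.lean` (val-lit X5). Discharges the named fact
`BILPS2019_thm33 F : IsNPHard (hquadLanguage F)` ("`HQuad_{{0,1,−1}, F}` is NP-hard for any field
`F`", arXiv:1911.02534 p0033:L38; proof p0033:L40–L72) for EVERY field `F`, exactly along the printed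
route: ONE polynomial-time Karp map from GRAPH 3-COLOURABILITY (`THREECOL`, NP-hard by
`THREECOL_isNPHard`, tree file `ThreeColouringMachine.lean`) to the codes of systems of quadratic
forms with `{0, ±1}` coefficients.

* §A (the printed proof, p0033:L42–L72): for a graph `G = (V, E)` the system with variables
  `x_v, y_v (v ∈ V), z`, vertex equations `x_v y_v = 0`, `x_v² − x_v z = 0`, `y_v² − y_v z = 0` and
  one edge equation `x_v² + y_v² + x_w² + y_w² − x_v y_w − x_w y_v − z² = 0` per edge has a
  NONTRIVIAL solution iff `G` is `3`-colourable (`BILPS19HQuad.exists_isSolution_iff`): "If `z = 0`,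
  then from vertex equations we deduce `x_v = y_v = 0` … We can scale it so that `z = 1`. When `z = 1`,
  the vertex equations give `(x_v, y_v) ∈ {(0,0),(0,1),(1,0)}`", and the table of the edge form on
  these values (`−1` on the diagonal pairs `(0,0),(0,0)`, `1` on equal nonzero colours, `0` otherwise)
  "forces the tuples `(x_v, y_v)` and `(x_w, y_w)` to be different".
  PRINT ERRATUM (disclosed): the held text prints the edge form as `… − x_v y_w − x_w y_w − z²`; with
  that form the table entry at `((0,1),(1,0))` would be `1`, not the printed `0`; the form realising the
  printed table (and the proof) is the `v ↔ w`-symmetric `… − x_v y_w − x_w y_v − z²`, used here.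
* §B (the instance): `N = 2n + 1` variables `x_v ↦ v`, `y_v ↦ n + v`, `z ↦ 2n`; each form is its
  `N × N` row-major `{0, ±1}` coefficient list (the format of `quadFormOfList`); `3n` vertex forms and
  `n²` pair slots (slot `(v, w)`: the edge form if the adjacency bits `(v,w)` and `(w,v)` are both set
  and `v ≠ w`; the killing form `z²` if bit `(v,w)` is set but `v = w` or bit `(w,v)` is not — so that
  bit matrices that are NOT graph codes go to non-members; the zero form otherwise);
  `BILPS19HQuad.instOf_mem_iff` (graph codes) and `BILPS19HQuad.instOf_not_mem_of_kill`.
* §C (the machine): the instance map on codes, in the typed `CodeFP` algebra (`CodeFP.lean`,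
  `CodeFPStrings.lean`: a graph code `⟨bin n, bits⟩` is parsed by `codeFP_hdrBody`, bits are read by
  `strGetDNat`, the tables are `brange`/`map` loops under a unary budget `(|bits| + 2)³`; ill-formed
  strings go to the fixed non-member `(0, [])`): `BILPS19HQuad.reduceGFP`.
* §D: `BILPS19HQuad.THREECOL_karpReducible_hquadLanguage`, **`BILPS2019_thm33_holds`**.

Theorem-only file (its `def`s are proof plumbing: the instance tables and the instance map; no
statement of `BILPS19MembershipHardness.lean` is touched, no new fact). HONEST FRAMING (val-lit):
typed literature; `VP ≠ VNP` is NOT proved and nothing here is progress on it.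

## References

* [BlaserIkenmeyerLysikovPandeySchreyer2019] M. Bläser, C. Ikenmeyer, V. Lysikov, A. Pandey,
  F.-O. Schreyer, *Variety membership testing, algebraic natural proofs, and geometric complexity
  theory*, arXiv:1911.02534, §8.1, Problem 4 and Thm. 33 (p0032:L36, p0033:L38–L72).
* [GareyJohnson1979] M. R. Garey, D. S. Johnson, *Computers and Intractability*, A1.1 GT4 (GRAPH
  3-COLORABILITY is NP-complete).
* [AroraBarak2009] S. Arora, B. Barak, *Computational Complexity: A Modern Approach*, CUP 2009,
  Def. 2.7 / Thm. 2.8 (Karp reductions; hardness propagates), §1.3, §0.1.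
-/

noncomputable section

namespace Literature.Barriers.ValiantsHypothesis

open Literature.Computability.AlgebraicComplexity Literature.Computability.Complexity
open _root_.Computability
open scoped Literature.Computability.Complexity.Notation

universe u

namespace BILPS19HQuad

/-! ### §A. The printed proof: nontrivial solutions ↔ proper 3-colourings -/

section Math

variable {F : Type u} [Field F] {n : ℕ}

/-- **The BILPS system of a graph** (p0033:L44–L52): vertex equations `x_v y_v = 0`,
`x_v² − x_v z = 0`, `y_v² − y_v z = 0` and the edge equations
`x_v² + y_v² + x_w² + y_w² − x_v y_w − x_w y_v − z² = 0` (module docstring: print erratum), as a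
predicate on an assignment `(x, y, z) ∈ F^V × F^V × F`.
[cite: BlaserIkenmeyerLysikovPandeySchreyer2019, Thm. 33 (proof)] -/
def IsSolution (G : SimpleGraph (Fin n)) (x y : Fin n → F) (z : F) : Prop :=
  (∀ v, x v * y v = 0 ∧ x v * x v - x v * z = 0 ∧ y v * y v - y v * z = 0) ∧
    ∀ v w, G.Adj v w →
      x v * x v + y v * y v + x w * x w + y w * y w - x v * y w - x w * y v - z * z = 0

/-- "If `z = 0`, then from vertex equations we deduce `x_v = y_v = 0` for all `v ∈ V`. Therefore, a
nontrivial solution must have nonzero `z`." (p0033:L53–54)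
[cite: BlaserIkenmeyerLysikovPandeySchreyer2019, Thm. 33 (proof)] -/
theorem z_ne_zero_of_isSolution {G : SimpleGraph (Fin n)} {x y : Fin n → F} {z : F}
    (h : IsSolution G x y z) (hne : ¬ (x = 0 ∧ y = 0 ∧ z = 0)) : z ≠ 0 := by
  intro hz
  subst hz
  apply hne
  refine ⟨funext fun v => ?_, funext fun v => ?_, rfl⟩
  · have h2 := (h.1 v).2.1
    rw [mul_zero, sub_zero] at h2
    exact mul_self_eq_zero.mp h2
  · have h3 := (h.1 v).2.2
    rw [mul_zero, sub_zero] at h3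
    exact mul_self_eq_zero.mp h3

/-- The vertex equations force `x_v, y_v ∈ {0, z}` and not both `= z ≠ 0` ("the vertex equations
give `(x_v, y_v) ∈ {(0,0),(0,1),(1,0)}`" after scaling, p0033:L55).
[cite: BlaserIkenmeyerLysikovPandeySchreyer2019, Thm. 33 (proof)] -/
theorem vertex_values {G : SimpleGraph (Fin n)} {x y : Fin n → F} {z : F} (h : IsSolution G x y z)
    (v : Fin n) : (x v = 0 ∨ x v = z) ∧ (y v = 0 ∨ y v = z) ∧ (x v = 0 ∨ y v = 0) := by
  obtain ⟨h1, h2, h3⟩ := h.1 v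
  refine ⟨?_, ?_, mul_eq_zero.mp h1⟩
  · have : x v * (x v - z) = 0 := by rw [mul_sub]; exact h2
    rcases mul_eq_zero.mp this with h0 | h0
    · exact Or.inl h0
    · exact Or.inr (sub_eq_zero.mp h0)
  · have : y v * (y v - z) = 0 := by rw [mul_sub]; exact h3
    rcases mul_eq_zero.mp this with h0 | h0
    · exact Or.inl h0
    · exact Or.inr (sub_eq_zero.mp h0)

/-- **Nontrivial solutions give proper 3-colourings** (p0033:L55–L71: the colour of `v` is read off
`(x_v, y_v) ∈ {(z,0), (0,z), (0,0)}`; on equal colours the edge form takes the value `z²`, `z²`,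
`−z²` respectively — the diagonal of the printed table — which is nonzero).
[cite: BlaserIkenmeyerLysikovPandeySchreyer2019, Thm. 33 (proof)] -/
theorem colorable_of_isSolution {G : SimpleGraph (Fin n)} {x y : Fin n → F} {z : F}
    (h : IsSolution G x y z) (hne : ¬ (x = 0 ∧ y = 0 ∧ z = 0)) : G.Colorable 3 := by
  classical
  have hz : z ≠ 0 := z_ne_zero_of_isSolution h hne
  let col : Fin n → Fin 3 := fun v => if x v = z then 0 else if y v = z then 1 else 2
  refine ⟨SimpleGraph.Coloring.mk col fun {v w} hvw hcw => ?_⟩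
  have hE := h.2 v w hvw
  obtain ⟨hxv, hyv, hxyv⟩ := vertex_values h v
  obtain ⟨hxw, hyw, hxyw⟩ := vertex_values h w
  have hzz : z * z ≠ 0 := mul_ne_zero hz hz
  simp only [col] at hcw
  by_cases hv0 : x v = z
  · -- colour 0 at v, hence at w
    have hw0 : x w = z := by
      by_contra hw0
      rw [if_pos hv0, if_neg hw0] at hcw
      split_ifs at hcw <;> exact absurd hcw (by decide)
    have hyv0 : y v = 0 := hxyv.resolve_left (by rw [hv0]; exact hz)
    have hyw0 : y w = 0 := hxyw.resolve_left (by rw [hw0]; exact hz)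
    rw [hv0, hw0, hyv0, hyw0] at hE
    apply hzz
    linear_combination hE
  · by_cases hv1 : y v = z
    · have hw1 : y w = z := by
        by_contra hw1
        rw [if_neg hv0, if_pos hv1] at hcw
        split_ifs at hcw <;> exact absurd hcw (by decide)
      have hxv0 : x v = 0 := hxv.resolve_right hv0
      have hxw0 : x w = 0 := hxyw.symm.resolve_left (by rw [hw1]; exact hz)
      rw [hxv0, hxw0, hv1, hw1] at hE
      apply hzz
      linear_combination hE
    · have hxv0 : x v = 0 := hxv.resolve_right hv0
      have hyv0 : y v = 0 := hyv.resolve_right hv1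
      have hw0 : ¬ x w = z := by
        intro hw0
        rw [if_neg hv0, if_neg hv1, if_pos hw0] at hcw
        exact absurd hcw (by decide)
      have hw1 : ¬ y w = z := by
        intro hw1
        rw [if_neg hv0, if_neg hv1, if_neg hw0, if_pos hw1] at hcw
        exact absurd hcw (by decide)
      have hxw0 : x w = 0 := hxw.resolve_right hw0
      have hyw0 : y w = 0 := hyw.resolve_right hw1
      rw [hxv0, hyv0, hxw0, hyw0] at hE
      apply hzz
      linear_combination -hE

/-- **Proper 3-colourings give nontrivial solutions** with `z = 1` ("nontrivial solutions with `z = 1`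
are in one-to-one correspondence with colorings of the graph `G` into three colors, given by the
three possible solutions of the vertex equations", p0033:L70–L71; the off-diagonal entries of the
printed table are `0`). [cite: BlaserIkenmeyerLysikovPandeySchreyer2019, Thm. 33 (proof)] -/
theorem exists_isSolution_of_colorable {G : SimpleGraph (Fin n)} (hc : G.Colorable 3) :
    ∃ x y : Fin n → F, IsSolution G x y 1 := by
  classical
  obtain ⟨C⟩ := hc
  refine ⟨fun v => if C v = 0 then 1 else 0, fun v => if C v = 1 then 1 else 0, fun v => ?_,
    fun v w hvw => ?_⟩
  · have h3 : ∀ a : Fin 3, ((if a = 0 then (1 : F) else 0) * (if a = 1 then 1 else 0) = 0 ∧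
        (if a = 0 then (1 : F) else 0) * (if a = 0 then 1 else 0) - (if a = 0 then 1 else 0) * 1 = 0 ∧
        (if a = 1 then (1 : F) else 0) * (if a = 1 then 1 else 0) - (if a = 1 then 1 else 0) * 1 = 0) := by
      intro a
      fin_cases a <;> simp
    exact h3 (C v)
  · have hne : C v ≠ C w := C.valid hvw
    have h9 : ∀ a b : Fin 3, a ≠ b →
        (if a = 0 then (1 : F) else 0) * (if a = 0 then 1 else 0) +
          (if a = 1 then (1 : F) else 0) * (if a = 1 then 1 else 0) +
          (if b = 0 then (1 : F) else 0) * (if b = 0 then 1 else 0) +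
          (if b = 1 then (1 : F) else 0) * (if b = 1 then 1 else 0) -
          (if a = 0 then (1 : F) else 0) * (if b = 1 then 1 else 0) -
          (if b = 0 then (1 : F) else 0) * (if a = 1 then 1 else 0) - 1 * 1 = 0 := by
      intro a b hab
      fin_cases a <;> fin_cases b <;> simp_all
    exact h9 (C v) (C w) hne

/-- **The printed equivalence** (p0033:L42–L72): the BILPS system of `G` has a nontrivial solution
iff `G` is `3`-colourable; every field. [cite: BlaserIkenmeyerLysikovPandeySchreyer2019, Thm. 33 (proof)] -/
theorem exists_isSolution_iff (G : SimpleGraph (Fin n)) :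
    (∃ (x y : Fin n → F) (z : F), ¬ (x = 0 ∧ y = 0 ∧ z = 0) ∧ IsSolution G x y z) ↔ G.Colorable 3 := by
  constructor
  · rintro ⟨x, y, z, hne, h⟩
    exact colorable_of_isSolution h hne
  · intro hc
    obtain ⟨x, y, h⟩ := exists_isSolution_of_colorable (F := F) hc
    exact ⟨x, y, 1, fun h0 => one_ne_zero h0.2.2, h⟩

end Math

/-! ### §B. The instance: coefficient tables of the forms -/

section Instance

/-- The number of variables `N = 2n + 1` (`x_v ↦ v`, `y_v ↦ n + v`, `z ↦ 2n`).
[cite: BlaserIkenmeyerLysikovPandeySchreyer2019, Thm. 33 (proof)] -/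
def nvars (n : ℕ) : ℕ := 2 * n + 1

/-- A sparse `{0, ±1}` coefficient table given by a list of `(coefficient, row, column)`: the entry
`(i, j)` is the coefficient of the first listed term at `(i, j)`, `0` if none (an `if`-chain, the
shape the machine of §C computes). [cite: BlaserIkenmeyerLysikovPandeySchreyer2019, Problem 4 (lists of coefficients)] -/
def firstMatch (T : List (ℤ × ℕ × ℕ)) (i j : ℕ) : ℤ :=
  T.foldr (fun t acc => if i = t.2.1 ∧ j = t.2.2 then t.1 else acc) 0

/-- The seven terms of the edge form `x_v² + y_v² + x_w² + y_w² − x_v y_w − x_w y_v − z²`.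
[cite: BlaserIkenmeyerLysikovPandeySchreyer2019, Thm. 33 (proof, edge equation)] -/
def edgeTerms (n v w : ℕ) : List (ℤ × ℕ × ℕ) :=
  [(1, v, v), (1, n + v, n + v), (1, w, w), (1, n + w, n + w), (-1, v, n + w), (-1, w, n + v),
    (-1, 2 * n, 2 * n)]

/-- The terms of form number `q` of the instance of `(n, bits)`: `q = 3v + κ < 3n` the three vertex
forms `x_v y_v`, `x_v² − x_v z`, `y_v² − y_v z`; `q = 3n + (w + n v)` the pair slot `(v, w)`: the
edge form if bits `(v,w)`, `(w,v)` are set and `v ≠ w`, the killing form `z²` if bit `(v,w)` is set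
but `v = w` or bit `(w,v)` is not, no term otherwise (bit `(v, w)` sits at position `w + n v`, the
row-major layout of `encodingGraphFin`). [cite: BlaserIkenmeyerLysikovPandeySchreyer2019, Thm. 33 (proof)] -/
def termsOf (n : ℕ) (b : List Bool) (q : ℕ) : List (ℤ × ℕ × ℕ) :=
  if q < 3 * n then
    if q % 3 = 0 then [(1, q / 3, n + q / 3)]
    else if q % 3 = 1 then [(1, q / 3, q / 3), (-1, q / 3, 2 * n)]
    else [(1, n + q / 3, n + q / 3), (-1, n + q / 3, 2 * n)]
  else
    if b.getD ((q - 3 * n) % n + n * ((q - 3 * n) / n)) false then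
      if (q - 3 * n) / n = (q - 3 * n) % n ∨ b.getD ((q - 3 * n) / n + n * ((q - 3 * n) % n)) false = false
      then [(1, 2 * n, 2 * n)]
      else edgeTerms n ((q - 3 * n) / n) ((q - 3 * n) % n)
    else []

/-- Entry `(i, j)` of form `q`. [cite: BlaserIkenmeyerLysikovPandeySchreyer2019, Thm. 33 (proof)] -/
def entryOf (n : ℕ) (b : List Bool) (q i j : ℕ) : ℤ :=
  firstMatch (termsOf n b q) i j

/-- Form `q` as its row-major `N × N` coefficient list. [cite: BlaserIkenmeyerLysikovPandeySchreyer2019, Problem 4 (lists of coefficients)] -/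
def formOf (n : ℕ) (b : List Bool) (q : ℕ) : List ℤ :=
  (List.range (nvars n * nvars n)).map fun t => entryOf n b q (t / nvars n) (t % nvars n)

/-- **The `HQuad` instance of `(n, bits)`**: `N = 2n + 1` variables and the `3n + n²` forms.
[cite: BlaserIkenmeyerLysikovPandeySchreyer2019, Thm. 33 (proof)] -/
def instOf (n : ℕ) (b : List Bool) : ℕ × List (List ℤ) :=
  (nvars n, (List.range (3 * n + n * n)).map (formOf n b))

/-- The fixed non-member `(0, [])` (no nonzero vector in `F⁰`). [cite: BlaserIkenmeyerLysikovPandeySchreyer2019, Problem 4] -/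
def badInst : ℕ × List (List ℤ) := (0, [])

variable (F : Type u) [Field F]

/-- The yes-instances of `HQuad_{{0,1,−1},F}` (the set whose codes form `hquadLanguage F`).
[cite: BlaserIkenmeyerLysikovPandeySchreyer2019, Problem 4] -/
def hquadSet : Set (ℕ × List (List ℤ)) :=
  {x | (∀ l ∈ x.2, l.length = x.1 ^ 2 ∧ ∀ a ∈ l, a = 0 ∨ a = 1 ∨ a = -1) ∧
    ∃ v : Fin x.1 → F, v ≠ 0 ∧ ∀ l ∈ x.2, quadFormOfList F x.1 l v = 0}

/-- `hquadLanguage F` is the language of codes of `hquadSet F` (definitional).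
[cite: BlaserIkenmeyerLysikovPandeySchreyer2019, Problem 4] -/
theorem hquadLanguage_eq : hquadLanguage F = hquadInstEncoding.toLanguage (hquadSet F) := rfl

/-- `badInst ∉ hquadSet`. [cite: BlaserIkenmeyerLysikovPandeySchreyer2019, Problem 4] -/
theorem badInst_not_mem : badInst ∉ hquadSet F := by
  rintro ⟨-, v, hv, -⟩
  exact hv (funext fun i => i.elim0)

variable {F}

/-! #### Values of the tables -/

/-- Unfolding of `firstMatch` on a cons. [folklore] -/
private theorem firstMatch_cons (t : ℤ × ℕ × ℕ) (T : List (ℤ × ℕ × ℕ)) (i j : ℕ) :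
    firstMatch (t :: T) i j = if i = t.2.1 ∧ j = t.2.2 then t.1 else firstMatch T i j := rfl

/-- A position listed nowhere has entry `0`. [folklore] -/
private theorem firstMatch_eq_zero {T : List (ℤ × ℕ × ℕ)} {i j : ℕ}
    (h : ∀ t ∈ T, ¬ (i = t.2.1 ∧ j = t.2.2)) : firstMatch T i j = 0 := by
  induction T with
  | nil => rfl
  | cons t T ih =>
    rw [firstMatch_cons, if_neg (h t List.mem_cons_self)]
    exact ih fun t' ht' => h t' (List.mem_cons_of_mem _ ht')

/-- A first-match value is `0` or one of the listed coefficients. [folklore] -/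
private theorem firstMatch_mem (T : List (ℤ × ℕ × ℕ)) (i j : ℕ) :
    firstMatch T i j = 0 ∨ ∃ t ∈ T, firstMatch T i j = t.1 := by
  induction T with
  | nil => exact Or.inl rfl
  | cons t T ih =>
    by_cases h : i = t.2.1 ∧ j = t.2.2
    · exact Or.inr ⟨t, List.mem_cons_self, by simp [firstMatch, List.foldr, h]⟩
    · have hft : firstMatch (t :: T) i j = firstMatch T i j := by
        simp [firstMatch, List.foldr, h]
      rw [hft]
      rcases ih with h0 | ⟨t', ht', h'⟩
      · exact Or.inl h0
      · exact Or.inr ⟨t', List.mem_cons_of_mem _ ht', h'⟩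

/-- All listed coefficients are `±1`. [cite: BlaserIkenmeyerLysikovPandeySchreyer2019, Thm. 33 (coefficients from {−1,0,1})] -/
theorem coeff_termsOf (n : ℕ) (b : List Bool) (q : ℕ) :
    ∀ t ∈ termsOf n b q, t.1 = 1 ∨ t.1 = -1 := by
  intro t ht
  unfold termsOf edgeTerms at ht
  split_ifs at ht <;> simp only [List.mem_cons, List.not_mem_nil, or_false] at ht <;>
    rcases ht with rfl | rfl | rfl | rfl | rfl | rfl | rfl <;> simp

/-- **Coefficients from `{0, 1, −1}`** (Thm 33: "`HQuad_{{0,1,−1},F}`").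
[cite: BlaserIkenmeyerLysikovPandeySchreyer2019, Thm. 33] -/
theorem entryOf_mem (n : ℕ) (b : List Bool) (q i j : ℕ) :
    entryOf n b q i j = 0 ∨ entryOf n b q i j = 1 ∨ entryOf n b q i j = -1 := by
  rcases firstMatch_mem (termsOf n b q) i j with h | ⟨t, ht, h⟩
  · exact Or.inl h
  · rw [entryOf, h]
    exact Or.inr (coeff_termsOf n b q t ht)

/-- The forms have length `N²` and entries in `{0, ±1}`.
[cite: BlaserIkenmeyerLysikovPandeySchreyer2019, Thm. 33] -/
theorem formOf_wellFormed (n : ℕ) (b : List Bool) (q : ℕ) :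
    (formOf n b q).length = nvars n ^ 2 ∧ ∀ a ∈ formOf n b q, a = 0 ∨ a = 1 ∨ a = -1 := by
  refine ⟨by rw [formOf, List.length_map, List.length_range, sq], fun a ha => ?_⟩
  rw [formOf, List.mem_map] at ha
  obtain ⟨t, -, rfl⟩ := ha
  exact entryOf_mem n b q _ _

/-- Reading an entry of a form back from its list. [folklore] -/
private theorem getD_formOf (n : ℕ) (b : List Bool) (q : ℕ) (i j : Fin (nvars n)) :
    (formOf n b q).getD (i.1 * nvars n + j.1) 0 = entryOf n b q i j := by
  have hlt : i.1 * nvars n + j.1 < nvars n * nvars n := by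
    calc i.1 * nvars n + j.1 < i.1 * nvars n + nvars n := by have := j.2; omega
      _ = (i.1 + 1) * nvars n := by ring
      _ ≤ nvars n * nvars n := Nat.mul_le_mul_right _ (by have := i.2; omega)
  rw [formOf, List.getD_eq_getElem _ _ (by rw [List.length_map, List.length_range]; exact hlt),
    List.getElem_map, List.getElem_range]
  have hN : 0 < nvars n := by unfold nvars; omega
  congr 1
  · rw [Nat.add_comm, Nat.add_mul_div_right _ _ hN, Nat.div_eq_of_lt j.2, zero_add]
  · rw [Nat.add_comm, Nat.add_mul_mod_self_right, Nat.mod_eq_of_lt j.2]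

variable (F) in
/-- Coordinates of a vector of `F^N` by natural-number index (`0` past `N`). [folklore] -/
def coordAt {N : ℕ} (v : Fin N → F) (k : ℕ) : F :=
  if h : k < N then v ⟨k, h⟩ else 0

/-- The value of a form is the first-match table summed against `v_i v_j`. [folklore] -/
private theorem quadFormOfList_formOf (n : ℕ) (b : List Bool) (q : ℕ) (v : Fin (nvars n) → F) :
    quadFormOfList F (nvars n) (formOf n b q) v =
      ∑ i : Fin (nvars n), ∑ j : Fin (nvars n), (entryOf n b q i j : F) * v i * v j := by
  unfold quadFormOfList
  refine Finset.sum_congr rfl fun i _ => Finset.sum_congr rfl fun j _ => ?_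
  rw [getD_formOf]

/-- A single indicator against `v_i v_j` picks `v_a v_b`. [folklore] -/
private theorem sum_sum_indicator {N : ℕ} (v : Fin N → F) (c : F) (a b : ℕ) (ha : a < N) (hb : b < N) :
    ∑ i : Fin N, ∑ j : Fin N, (if (i : ℕ) = a ∧ (j : ℕ) = b then c else 0) * v i * v j =
      c * coordAt F v a * coordAt F v b := by
  rw [Finset.sum_eq_single ⟨a, ha⟩ (fun i _ hi => Finset.sum_eq_zero fun j _ => by
      have : ¬ ((i : ℕ) = a ∧ (j : ℕ) = b) := fun h => hi (Fin.ext h.1)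
      rw [if_neg this, zero_mul, zero_mul]) (fun h => absurd (Finset.mem_univ _) h)]
  rw [Finset.sum_eq_single ⟨b, hb⟩ (fun j _ hj => by
      have : ¬ ((a : ℕ) = a ∧ (j : ℕ) = b) := fun h => hj (Fin.ext h.2)
      rw [if_neg this, zero_mul, zero_mul]) (fun h => absurd (Finset.mem_univ _) h)]
  simp [coordAt, ha, hb]

/-- **Evaluation of a first-match table with pairwise distinct positions** inside the `N × N` square:
the value is `∑_t c_t v_{a_t} v_{b_t}`. [folklore] -/
private theorem sum_sum_firstMatch {N : ℕ} (v : Fin N → F) (T : List (ℤ × ℕ × ℕ))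
    (hd : T.Pairwise fun s t => s.2 ≠ t.2) (hN : ∀ t ∈ T, t.2.1 < N ∧ t.2.2 < N) :
    ∑ i : Fin N, ∑ j : Fin N, (firstMatch T i j : F) * v i * v j =
      (T.map fun t => (t.1 : F) * coordAt F v t.2.1 * coordAt F v t.2.2).sum := by
  induction T with
  | nil => simp [firstMatch]
  | cons t T ih =>
    rw [List.pairwise_cons] at hd
    have hsplit : ∀ i j : ℕ, (firstMatch (t :: T) i j : F) =
        (if i = t.2.1 ∧ j = t.2.2 then (t.1 : F) else 0) + (firstMatch T i j : F) := by
      intro i j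
      rw [firstMatch_cons]
      by_cases h : i = t.2.1 ∧ j = t.2.2
      · -- at `t`'s position the tail contributes `0` (positions are pairwise distinct)
        have htail : firstMatch T i j = 0 :=
          firstMatch_eq_zero fun t' ht' h' => hd.1 t' ht' (Prod.ext (h.1.symm.trans h'.1) (h.2.symm.trans h'.2))
        rw [if_pos h, if_pos h, htail, Int.cast_zero, add_zero]
      · rw [if_neg h, if_neg h, zero_add]
    simp_rw [hsplit, add_mul, Finset.sum_add_distrib]
    rw [sum_sum_indicator v _ _ _ (hN t List.mem_cons_self).1 (hN t List.mem_cons_self).2,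
      ih hd.2 fun t' ht' => hN t' (List.mem_cons_of_mem _ ht'), List.map_cons, List.sum_cons]

/-- **The value of form `q`** at `v ∈ F^N`: the sum of its terms, whenever their positions are
pairwise distinct and inside the square. [cite: BlaserIkenmeyerLysikovPandeySchreyer2019, Thm. 33 (proof)] -/
theorem quadFormOfList_formOf_eq_sum (n : ℕ) (b : List Bool) (q : ℕ) (v : Fin (nvars n) → F)
    (hd : (termsOf n b q).Pairwise fun s t => s.2 ≠ t.2)
    (hN : ∀ t ∈ termsOf n b q, t.2.1 < nvars n ∧ t.2.2 < nvars n) :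
    quadFormOfList F (nvars n) (formOf n b q) v =
      ((termsOf n b q).map fun t => (t.1 : F) * coordAt F v t.2.1 * coordAt F v t.2.2).sum := by
  rw [quadFormOfList_formOf]
  exact sum_sum_firstMatch v _ hd hN

/-! #### The terms of each form -/

/-- Vertex form `3u`: `x_u y_u`. [cite: BlaserIkenmeyerLysikovPandeySchreyer2019, Thm. 33 (proof)] -/
theorem termsOf_vertex₀ (n : ℕ) (b : List Bool) {u : ℕ} (hu : u < n) :
    termsOf n b (3 * u) = [(1, u, n + u)] := by
  have h1 : 3 * u < 3 * n := by omega
  have h2 : 3 * u % 3 = 0 := by omega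
  have h3 : 3 * u / 3 = u := by omega
  simp [termsOf, h1, h2, h3]

/-- Vertex form `3u + 1`: `x_u² − x_u z`. [cite: BlaserIkenmeyerLysikovPandeySchreyer2019, Thm. 33 (proof)] -/
theorem termsOf_vertex₁ (n : ℕ) (b : List Bool) {u : ℕ} (hu : u < n) :
    termsOf n b (3 * u + 1) = [(1, u, u), (-1, u, 2 * n)] := by
  have h1 : 3 * u + 1 < 3 * n := by omega
  have h2 : (3 * u + 1) % 3 = 1 := by omega
  have h3 : (3 * u + 1) / 3 = u := by omega
  simp [termsOf, h1, h2, h3]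

/-- Vertex form `3u + 2`: `y_u² − y_u z`. [cite: BlaserIkenmeyerLysikovPandeySchreyer2019, Thm. 33 (proof)] -/
theorem termsOf_vertex₂ (n : ℕ) (b : List Bool) {u : ℕ} (hu : u < n) :
    termsOf n b (3 * u + 2) = [(1, n + u, n + u), (-1, n + u, 2 * n)] := by
  have h1 : 3 * u + 2 < 3 * n := by omega
  have h2 : (3 * u + 2) % 3 = 2 := by omega
  have h3 : (3 * u + 2) / 3 = u := by omega
  simp [termsOf, h1, h2, h3]

/-- The slot of the ordered pair `(u, w)` is form number `3n + (w + n u)`; its quotient and remainder.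
[folklore] -/
private theorem slot_div_mod {n u w : ℕ} (_hu : u < n) (hw : w < n) :
    ¬ 3 * n + (w + n * u) < 3 * n ∧ (w + n * u) / n = u ∧ (w + n * u) % n = w := by
  have hn : 0 < n := by omega
  refine ⟨by omega, ?_, ?_⟩
  · rw [Nat.add_mul_div_left _ _ hn, Nat.div_eq_of_lt hw, zero_add]
  · rw [Nat.add_mul_mod_self_left, Nat.mod_eq_of_lt hw]

/-- Pair slot `(u, w)` with bit `(u, w)` unset: no terms. [cite: BlaserIkenmeyerLysikovPandeySchreyer2019, Thm. 33 (proof)] -/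
theorem termsOf_slot_none (n : ℕ) (b : List Bool) {u w : ℕ} (hu : u < n) (hw : w < n)
    (h : b.getD (w + n * u) false = false) : termsOf n b (3 * n + (w + n * u)) = [] := by
  obtain ⟨h1, h2, h3⟩ := slot_div_mod hu hw
  rw [termsOf, if_neg h1, Nat.add_sub_cancel_left, h2, h3, h]
  simp

/-- Pair slot `(u, w)` with bit `(u, w)` set but `u = w` or bit `(w, u)` unset: the killing form `z²`.
[cite: BlaserIkenmeyerLysikovPandeySchreyer2019, Thm. 33 (proof)] -/
theorem termsOf_slot_kill (n : ℕ) (b : List Bool) {u w : ℕ} (hu : u < n) (hw : w < n)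
    (h : b.getD (w + n * u) false = true) (h' : u = w ∨ b.getD (u + n * w) false = false) :
    termsOf n b (3 * n + (w + n * u)) = [(1, 2 * n, 2 * n)] := by
  obtain ⟨h1, h2, h3⟩ := slot_div_mod hu hw
  rw [termsOf, if_neg h1, Nat.add_sub_cancel_left, h2, h3, h, if_pos rfl, if_pos h']

/-- Pair slot `(u, w)` of an edge (`u ≠ w`, both bits set): the edge form.
[cite: BlaserIkenmeyerLysikovPandeySchreyer2019, Thm. 33 (proof)] -/
theorem termsOf_slot_edge (n : ℕ) (b : List Bool) {u w : ℕ} (hu : u < n) (hw : w < n)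
    (h : b.getD (w + n * u) false = true) (huw : u ≠ w) (h' : b.getD (u + n * w) false = true) :
    termsOf n b (3 * n + (w + n * u)) = edgeTerms n u w := by
  obtain ⟨h1, h2, h3⟩ := slot_div_mod hu hw
  rw [termsOf, if_neg h1, Nat.add_sub_cancel_left, h2, h3, h, if_pos rfl, if_neg]
  rintro (e | e)
  · exact huw e
  · rw [h'] at e
    exact absurd e (by decide)

/-! #### Assignments `(x, y, z) ↔ v ∈ F^{2n+1}` -/

/-- The vector `v ∈ F^{2n+1}` of an assignment: `v_u = x_u`, `v_{n+u} = y_u`, `v_{2n} = z`.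
[cite: BlaserIkenmeyerLysikovPandeySchreyer2019, Thm. 33 (proof)] -/
def vecOf {n : ℕ} (x y : Fin n → F) (z : F) : Fin (nvars n) → F := fun k =>
  if h : k.1 < n then x ⟨k.1, h⟩ else if h' : k.1 < 2 * n then y ⟨k.1 - n, by omega⟩ else z

/-- `v_u = x_u`. [folklore] -/
private theorem coordAt_vecOf_x {n : ℕ} (x y : Fin n → F) (z : F) (u : Fin n) :
    coordAt F (vecOf x y z) u = x u := by
  have hu : (u : ℕ) < nvars n := by unfold nvars; omega
  simp [coordAt, vecOf, hu, u.2]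

/-- `v_{n+u} = y_u`. [folklore] -/
private theorem coordAt_vecOf_y {n : ℕ} (x y : Fin n → F) (z : F) (u : Fin n) :
    coordAt F (vecOf x y z) (n + u) = y u := by
  have hu : n + (u : ℕ) < nvars n := by unfold nvars; omega
  have h1 : ¬ n + (u : ℕ) < n := by omega
  have h2 : n + (u : ℕ) < 2 * n := by omega
  simp [coordAt, vecOf, hu, h1, h2]

/-- `v_{2n} = z`. [folklore] -/
private theorem coordAt_vecOf_z {n : ℕ} (x y : Fin n → F) (z : F) :
    coordAt F (vecOf x y z) (2 * n) = z := by
  have hu : 2 * n < nvars n := by unfold nvars; omega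
  have h1 : ¬ 2 * n < n := by omega
  simp [coordAt, vecOf, hu, h1]

/-- A coordinate inside the range is the vector's value. [folklore] -/
private theorem coordAt_val {N : ℕ} (v : Fin N → F) (k : Fin N) : coordAt F v k = v k := by
  simp [coordAt, k.2]

/-- The assignment read off `v ∈ F^{2n+1}` is nontrivial when `v ≠ 0`. [folklore] -/
private theorem nontrivial_of_ne_zero {n : ℕ} {v : Fin (nvars n) → F} (hv : v ≠ 0) :
    ¬ ((fun u : Fin n => coordAt F v u) = 0 ∧ (fun u : Fin n => coordAt F v (n + u)) = 0 ∧
      coordAt F v (2 * n) = 0) := by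
  rintro ⟨hx, hy, hz⟩
  apply hv
  funext k
  rw [← coordAt_val v k]
  by_cases h1 : (k : ℕ) < n
  · exact congrFun hx ⟨k, h1⟩
  · by_cases h2 : (k : ℕ) < 2 * n
    · have hk : (k : ℕ) = n + ((k : ℕ) - n) := by omega
      rw [hk]
      exact congrFun hy ⟨(k : ℕ) - n, by omega⟩
    · have hk : (k : ℕ) = 2 * n := by have := k.2; unfold nvars at this; omega
      rw [hk]
      exact hz

/-! #### Values of the forms -/

section Values

variable (n : ℕ) (b : List Bool) (v : Fin (nvars n) → F)

/-- Value of vertex form `3u`: `x_u y_u`. [cite: BlaserIkenmeyerLysikovPandeySchreyer2019, Thm. 33 (proof)] -/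
theorem eval_vertex₀ {u : ℕ} (hu : u < n) :
    quadFormOfList F (nvars n) (formOf n b (3 * u)) v = coordAt F v u * coordAt F v (n + u) := by
  rw [quadFormOfList_formOf_eq_sum n b _ v (by rw [termsOf_vertex₀ n b hu]; simp)
    (by rw [termsOf_vertex₀ n b hu]; simp [nvars]; omega), termsOf_vertex₀ n b hu]
  simp

/-- Value of vertex form `3u + 1`: `x_u² − x_u z`. [cite: BlaserIkenmeyerLysikovPandeySchreyer2019, Thm. 33 (proof)] -/
theorem eval_vertex₁ {u : ℕ} (hu : u < n) :
    quadFormOfList F (nvars n) (formOf n b (3 * u + 1)) v =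
      coordAt F v u * coordAt F v u - coordAt F v u * coordAt F v (2 * n) := by
  rw [quadFormOfList_formOf_eq_sum n b _ v
    (by rw [termsOf_vertex₁ n b hu]; simp; omega)
    (by rw [termsOf_vertex₁ n b hu]; simp [nvars]; omega), termsOf_vertex₁ n b hu]
  simp [sub_eq_add_neg]

/-- Value of vertex form `3u + 2`: `y_u² − y_u z`. [cite: BlaserIkenmeyerLysikovPandeySchreyer2019, Thm. 33 (proof)] -/
theorem eval_vertex₂ {u : ℕ} (hu : u < n) :
    quadFormOfList F (nvars n) (formOf n b (3 * u + 2)) v =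
      coordAt F v (n + u) * coordAt F v (n + u) - coordAt F v (n + u) * coordAt F v (2 * n) := by
  rw [quadFormOfList_formOf_eq_sum n b _ v
    (by rw [termsOf_vertex₂ n b hu]; simp; omega)
    (by rw [termsOf_vertex₂ n b hu]; simp [nvars]; omega), termsOf_vertex₂ n b hu]
  simp [sub_eq_add_neg]

/-- Value of an unset slot: `0`. [cite: BlaserIkenmeyerLysikovPandeySchreyer2019, Thm. 33 (proof)] -/
theorem eval_slot_none {u w : ℕ} (hu : u < n) (hw : w < n) (h : b.getD (w + n * u) false = false) :
    quadFormOfList F (nvars n) (formOf n b (3 * n + (w + n * u))) v = 0 := by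
  rw [quadFormOfList_formOf_eq_sum n b _ v (by rw [termsOf_slot_none n b hu hw h]; simp)
    (by rw [termsOf_slot_none n b hu hw h]; simp), termsOf_slot_none n b hu hw h]
  simp

/-- Value of a killing slot: `z²`. [cite: BlaserIkenmeyerLysikovPandeySchreyer2019, Thm. 33 (proof)] -/
theorem eval_slot_kill {u w : ℕ} (hu : u < n) (hw : w < n) (h : b.getD (w + n * u) false = true)
    (h' : u = w ∨ b.getD (u + n * w) false = false) :
    quadFormOfList F (nvars n) (formOf n b (3 * n + (w + n * u))) v =
      coordAt F v (2 * n) * coordAt F v (2 * n) := by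
  rw [quadFormOfList_formOf_eq_sum n b _ v (by rw [termsOf_slot_kill n b hu hw h h']; simp)
    (by rw [termsOf_slot_kill n b hu hw h h']; simp [nvars]), termsOf_slot_kill n b hu hw h h']
  simp

/-- Value of an edge slot: the edge form `x_u² + y_u² + x_w² + y_w² − x_u y_w − x_w y_u − z²`.
[cite: BlaserIkenmeyerLysikovPandeySchreyer2019, Thm. 33 (proof)] -/
theorem eval_slot_edge {u w : ℕ} (hu : u < n) (hw : w < n) (h : b.getD (w + n * u) false = true)
    (huw : u ≠ w) (h' : b.getD (u + n * w) false = true) :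
    quadFormOfList F (nvars n) (formOf n b (3 * n + (w + n * u))) v =
      coordAt F v u * coordAt F v u + coordAt F v (n + u) * coordAt F v (n + u) +
        coordAt F v w * coordAt F v w + coordAt F v (n + w) * coordAt F v (n + w) -
        coordAt F v u * coordAt F v (n + w) - coordAt F v w * coordAt F v (n + u) -
        coordAt F v (2 * n) * coordAt F v (2 * n) := by
  rw [quadFormOfList_formOf_eq_sum n b _ v
    (by rw [termsOf_slot_edge n b hu hw h huw h']; simp [edgeTerms]; omega)
    (by rw [termsOf_slot_edge n b hu hw h huw h']; simp [edgeTerms, nvars]; omega),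
    termsOf_slot_edge n b hu hw h huw h']
  simp [edgeTerms]
  ring

end Values

/-! #### Membership of the instance -/

/-- The number of forms; the slot index of a pair is in range. [folklore] -/
private theorem slot_lt {n u w : ℕ} (hu : u < n) (hw : w < n) : 3 * n + (w + n * u) < 3 * n + n * n := by
  have : w + n * u < n * n := by
    calc w + n * u < n + n * u := by omega
      _ = n * (u + 1) := by ring
      _ ≤ n * n := Nat.mul_le_mul_left _ (by omega)
  omega

/-- Unfolding of membership of `instOf n b` in `hquadSet`: the well-formedness conjunct holds, and
the forms are indexed by `q < 3n + n²`. [cite: BlaserIkenmeyerLysikovPandeySchreyer2019, Problem 4] -/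
theorem instOf_mem_iff_exists (n : ℕ) (b : List Bool) :
    instOf n b ∈ hquadSet F ↔ ∃ v : Fin (nvars n) → F, v ≠ 0 ∧
      ∀ q < 3 * n + n * n, quadFormOfList F (nvars n) (formOf n b q) v = 0 := by
  simp only [hquadSet, instOf, Set.mem_setOf_eq, List.forall_mem_map, List.mem_range]
  exact ⟨fun h => h.2, fun h => ⟨fun q _ => formOf_wellFormed n b q, h⟩⟩

/-- **A killing slot kills every nontrivial zero**: if some bit `(u, w)` is set with `u = w` or bit
`(w, u)` unset (the bit matrix is not the code of a simple graph), the instance is a non-member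
(`z² = 0`, then the vertex forms give `x = y = 0`).
[cite: BlaserIkenmeyerLysikovPandeySchreyer2019, Thm. 33 (proof)] -/
theorem instOf_not_mem_of_kill (n : ℕ) (b : List Bool) {u w : ℕ} (hu : u < n) (hw : w < n)
    (h : b.getD (w + n * u) false = true) (h' : u = w ∨ b.getD (u + n * w) false = false) :
    instOf n b ∉ hquadSet F := by
  rw [instOf_mem_iff_exists]
  rintro ⟨v, hv, hq⟩
  have hz : coordAt F v (2 * n) = 0 := by
    have h0 := hq _ (slot_lt hu hw)
    rw [eval_slot_kill n b v hu hw h h'] at h0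
    exact mul_self_eq_zero.mp h0
  apply nontrivial_of_ne_zero hv
  refine ⟨funext fun u' => ?_, funext fun u' => ?_, hz⟩
  · have h0 := hq (3 * u' + 1) (by have := u'.2; omega)
    rw [eval_vertex₁ n b v u'.2, hz, mul_zero, sub_zero] at h0
    exact mul_self_eq_zero.mp h0
  · have h0 := hq (3 * u' + 2) (by have := u'.2; omega)
    rw [eval_vertex₂ n b v u'.2, hz, mul_zero, sub_zero] at h0
    exact mul_self_eq_zero.mp h0

/-- **Common zeros of the instance of a graph code are the solutions of the BILPS system.** For the
adjacency bits `b` of a simple graph `G` (bit `(u, w)` at `w + n u` is `[G.Adj u w]`), a nonzero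
common zero of the forms exists iff the system of `G` has a nontrivial solution.
[cite: BlaserIkenmeyerLysikovPandeySchreyer2019, Thm. 33 (proof)] -/
theorem exists_common_zero_iff {n : ℕ} (b : List Bool) (G : SimpleGraph (Fin n))
    (hb : ∀ u w : Fin n, b.getD (w + n * u) false = true ↔ G.Adj u w) :
    (∃ v : Fin (nvars n) → F, v ≠ 0 ∧ ∀ q < 3 * n + n * n, quadFormOfList F (nvars n) (formOf n b q) v = 0) ↔
      ∃ (x y : Fin n → F) (z : F), ¬ (x = 0 ∧ y = 0 ∧ z = 0) ∧ IsSolution G x y z := by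
  classical
  constructor
  · rintro ⟨v, hv, hq⟩
    refine ⟨fun u => coordAt F v u, fun u => coordAt F v (n + u), coordAt F v (2 * n),
      nontrivial_of_ne_zero hv, fun u => ⟨?_, ?_, ?_⟩, fun u w huw => ?_⟩
    · have h0 := hq (3 * u) (by have := u.2; omega)
      rwa [eval_vertex₀ n b v u.2] at h0
    · have h0 := hq (3 * u + 1) (by have := u.2; omega)
      rwa [eval_vertex₁ n b v u.2] at h0
    · have h0 := hq (3 * u + 2) (by have := u.2; omega)
      rwa [eval_vertex₂ n b v u.2] at h0
    · have h1 : b.getD (w + n * u) false = true := (hb u w).2 huw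
      have h2 : b.getD (u + n * w) false = true := (hb w u).2 huw.symm
      have hne : (u : ℕ) ≠ w := fun e => G.irrefl (by rwa [show w = u from (Fin.ext e).symm] at huw)
      have h0 := hq _ (slot_lt u.2 w.2)
      rwa [eval_slot_edge n b v u.2 w.2 h1 hne h2] at h0
  · rintro ⟨x, y, z, hne, hsol⟩
    refine ⟨vecOf x y z, fun h0 => hne ?_, fun q hq => ?_⟩
    · have hx : ∀ u, x u = 0 := fun u => by rw [← coordAt_vecOf_x x y z u, h0]; simp [coordAt]
      have hy : ∀ u, y u = 0 := fun u => by rw [← coordAt_vecOf_y x y z u, h0]; simp [coordAt]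
      have hz : z = 0 := by rw [← coordAt_vecOf_z x y z, h0]; simp [coordAt]
      exact ⟨funext hx, funext hy, hz⟩
    · by_cases hq3 : q < 3 * n
      · -- a vertex form
        set u : Fin n := ⟨q / 3, by omega⟩ with hu
        obtain ⟨e0, e1, e2⟩ := hsol.1 u
        have hq' : q = 3 * (q / 3) + q % 3 := (Nat.div_add_mod q 3).symm
        have hlt : q % 3 < 3 := Nat.mod_lt _ (by norm_num)
        interval_cases hr : q % 3
        · rw [add_zero] at hq'
          rw [hq', eval_vertex₀ n b _ u.2, coordAt_vecOf_x, coordAt_vecOf_y]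
          exact e0
        · rw [hq', eval_vertex₁ n b _ u.2, coordAt_vecOf_x, coordAt_vecOf_z]
          exact e1
        · rw [hq', eval_vertex₂ n b _ u.2, coordAt_vecOf_y, coordAt_vecOf_z]
          exact e2
      · -- a pair slot
        have hn : 0 < n := by
          rcases Nat.eq_zero_or_pos n with rfl | hn
          · omega
          · exact hn
        set p := q - 3 * n with hp
        have hpq : q = 3 * n + (p % n + n * (p / n)) := by
          have := Nat.div_add_mod p n; omega
        have hun : p / n < n := by
          apply Nat.div_lt_of_lt_mul; rw [hp]; omega
        have hwn : p % n < n := Nat.mod_lt _ hn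
        set u : Fin n := ⟨p / n, hun⟩
        set w : Fin n := ⟨p % n, hwn⟩
        rw [hpq]
        rcases hget : b.getD (p % n + n * (p / n)) false with _ | _
        · exact eval_slot_none n b _ hun hwn hget
        · have hadj : G.Adj u w := (hb u w).1 hget
          have hne' : (p / n) ≠ p % n := fun e => G.irrefl (by
            rwa [show w = u from Fin.ext e.symm] at hadj)
          have h2 : b.getD (p / n + n * (p % n)) false = true := (hb w u).2 hadj.symm
          rw [eval_slot_edge n b _ hun hwn hget hne' h2, coordAt_vecOf_x x y z u,
            coordAt_vecOf_x x y z w, coordAt_vecOf_y x y z u, coordAt_vecOf_y x y z w,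
            coordAt_vecOf_z]
          exact hsol.2 u w hadj

/-- **The instance of a graph code is a yes-instance iff the graph is 3-colourable.**
[cite: BlaserIkenmeyerLysikovPandeySchreyer2019, Thm. 33 (proof)] -/
theorem instOf_mem_iff {n : ℕ} (b : List Bool) (G : SimpleGraph (Fin n))
    (hb : ∀ u w : Fin n, b.getD (w + n * u) false = true ↔ G.Adj u w) :
    instOf n b ∈ hquadSet F ↔ G.Colorable 3 := by
  rw [instOf_mem_iff_exists, exists_common_zero_iff b G hb, exists_isSolution_iff]

end Instance

/-! ### §C. The machine: the instance map on codes, in the typed `CodeFP` algebra -/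

section Machine

open CodeFP Brick

/-- The code of an `HQuad` instance `(N, forms)`: `hquadInstEncoding`, i.e. a binary numeral paired
with a headed list of headed lists of sign–magnitude integers.
[cite: BlaserIkenmeyerLysikovPandeySchreyer2019, Problem 4 (input)] -/
def hqE : ℕ × List (List ℤ) → List Bool := pairE natE (listE (listE smE))

/-- `hqE` is `hquadInstEncoding.encode`. [cite: AroraBarak2009, §0.1 (codes of pairs and lists)] -/
theorem hqE_eq : (hquadInstEncoding.encode : ℕ × List (List ℤ) → List Bool) = hqE := by
  unfold hqE hquadInstEncoding smE
  rw [pairE_eq, listE_eq, listE_eq, natE_eq]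

/-- The header `(n, bits)` read off a string `w = ⟨bin n, bits⟩` (value of the first field, the
second field). [cite: AroraBarak2009, §0.1] -/
def hdrOf (w : List Bool) : ℕ × List Bool := (bitsToNat (fstF w), sndF w)

/-- **The code test**: `w` is the canonical pair of a canonical numeral `bin n` and a bit block of
length `n²` — exactly the strings of the form `⟨bin n, s⟩`, `|s| = n²`, among which are the graph
codes (`encodingGraph`). [cite: AroraBarak2009, §0.1 (adjacency-matrix representation)] -/
def isGCode (w : List Bool) : Bool :=
  decide (boolPair (encodeNat (hdrOf w).1) (hdrOf w).2 = w) &&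
    decide ((hdrOf w).2.length = (hdrOf w).1 * (hdrOf w).1)

/-- **The instance map on all strings**: graph-shaped codes go to the instance of their header,
everything else to the fixed non-member. [cite: BlaserIkenmeyerLysikovPandeySchreyer2019, Thm. 33 (proof)] -/
def reduceG (w : List Bool) : ℕ × List (List ℤ) :=
  if isGCode w then instOf (hdrOf w).1 (hdrOf w).2 else badInst

/-- The unary loop budget `(|bits| + 2)³` (it dominates the number of forms `3n + n²` and the number
of entries `(2n+1)²` of a form when `|bits| = n²`). [cite: AroraBarak2009, §1.3 (polynomially bounded loops)] -/
def budget (b : List Bool) : ℕ := (b.length + 2) ^ 3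

/-- Form `q` tabulated under the budget (equal to `formOf` on graph-shaped codes).
[cite: AroraBarak2009, §1.3] -/
def formCapped (n : ℕ) (b : List Bool) (q : ℕ) : List ℤ :=
  (List.range (min (nvars n * nvars n) (List.replicate (budget b) ()).length)).map
    fun t => entryOf n b q (t / nvars n) (t % nvars n)

/-- The instance tabulated under the budget (equal to `instOf` on graph-shaped codes).
[cite: AroraBarak2009, §1.3] -/
def instCapped (p : ℕ × List Bool) : ℕ × List (List ℤ) :=
  (nvars p.1, (List.range (min (3 * p.1 + p.1 * p.1) (List.replicate (budget p.2) ()).length)).map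
    (formCapped p.1 p.2))

/-- The budget dominates both loop bounds when `|bits| = n²`. [folklore] -/
private theorem bounds_le_budget {n : ℕ} {b : List Bool} (h : b.length = n * n) :
    3 * n + n * n ≤ budget b ∧ nvars n * nvars n ≤ budget b := by
  unfold budget nvars
  rw [h]
  have hm : n ≤ n * n := Nat.le_mul_self n
  have hexp : (n * n + 2) ^ 3 = (n * n) ^ 3 + 6 * (n * n) ^ 2 + 12 * (n * n) + 8 := by ring
  have h2 : (2 * n + 1) * (2 * n + 1) = 4 * (n * n) + 4 * n + 1 := by ring
  rw [hexp, h2]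
  constructor <;> nlinarith [Nat.zero_le ((n * n) ^ 3), Nat.zero_le ((n * n) ^ 2)]

/-- On graph-shaped codes the capped tables are the tables. [folklore] -/
private theorem instCapped_eq {p : ℕ × List Bool} (h : p.2.length = p.1 * p.1) : instCapped p = instOf p.1 p.2 := by
  obtain ⟨n, b⟩ := p
  obtain ⟨h1, h2⟩ := bounds_le_budget h
  unfold instCapped instOf
  simp only [List.length_replicate, min_eq_left h1]
  congr 1
  refine List.map_congr_left fun q _ => ?_
  unfold formCapped formOf
  rw [List.length_replicate, min_eq_left h2]

/-- **Entry `(i, j)` of form `q` as an explicit decision tree on Boolean tests** — the shape the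
`CodeFP` term computes; equal to `entryOf` (`entryB_eq`). [cite: BlaserIkenmeyerLysikovPandeySchreyer2019, Thm. 33 (proof)] -/
def entryB (n : ℕ) (b : List Bool) (q i j : ℕ) : ℤ :=
  if decide (q < 3 * n) then
    if decide (q % 3 = 0) then
      (if decide (i = q / 3) && decide (j = n + q / 3) then 1 else 0)
    else if decide (q % 3 = 1) then
      (if decide (i = q / 3) && decide (j = q / 3) then 1
        else if decide (i = q / 3) && decide (j = 2 * n) then -1 else 0)
    else
      (if decide (i = n + q / 3) && decide (j = n + q / 3) then 1
        else if decide (i = n + q / 3) && decide (j = 2 * n) then -1 else 0)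
  else
    if b.getD ((q - 3 * n) % n + n * ((q - 3 * n) / n)) false then
      if decide ((q - 3 * n) / n = (q - 3 * n) % n) || !b.getD ((q - 3 * n) / n + n * ((q - 3 * n) % n)) false
      then (if decide (i = 2 * n) && decide (j = 2 * n) then 1 else 0)
      else
        (if decide (i = (q - 3 * n) / n) && decide (j = (q - 3 * n) / n) then 1
          else if decide (i = n + (q - 3 * n) / n) && decide (j = n + (q - 3 * n) / n) then 1
          else if decide (i = (q - 3 * n) % n) && decide (j = (q - 3 * n) % n) then 1
          else if decide (i = n + (q - 3 * n) % n) && decide (j = n + (q - 3 * n) % n) then 1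
          else if decide (i = (q - 3 * n) / n) && decide (j = n + (q - 3 * n) % n) then -1
          else if decide (i = (q - 3 * n) % n) && decide (j = n + (q - 3 * n) / n) then -1
          else if decide (i = 2 * n) && decide (j = 2 * n) then -1 else 0)
    else 0

/-- The decision tree computes the table. [folklore] -/
private theorem entryB_eq (n : ℕ) (b : List Bool) (q i j : ℕ) : entryB n b q i j = entryOf n b q i j := by
  have fm_ite : ∀ (c : Prop) [Decidable c] (A B : List (ℤ × ℕ × ℕ)),
      firstMatch (if c then A else B) i j = if c then firstMatch A i j else firstMatch B i j :=
    fun c _ A B => apply_ite (fun T => firstMatch T i j) c A B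
  have fm_nil : firstMatch [] i j = 0 := rfl
  unfold entryB entryOf termsOf
  simp only [fm_ite, firstMatch_cons, fm_nil, edgeTerms, decide_eq_true_eq, Bool.and_eq_true,
    Bool.or_eq_true, Bool.not_eq_true']

/-- The context of an entry: `(((n, bits), q), t)` — header, form number, position.
[cite: AroraBarak2009, §1.3] -/
abbrev ctxE : ((ℕ × List Bool) × ℕ) × ℕ → List Bool := pairE (pairE (pairE natE strE) natE) natE

/-- **The entry table on codes.** [cite: BlaserIkenmeyerLysikovPandeySchreyer2019, Thm. 33 (proof)] [cite: AroraBarak2009, §1.3] -/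
theorem entryFP : CodeFP ctxE smE
    (fun c => entryOf c.1.1.1 c.1.1.2 c.1.2 (c.2 / nvars c.1.1.1) (c.2 % nvars c.1.1.1)) := by
  have hn : CodeFP ctxE natE (fun c => c.1.1.1) := (fst _ _).fst'.fst'
  have hb : CodeFP ctxE strE (fun c => c.1.1.2) := (fst _ _).fst'.snd'
  have hq : CodeFP ctxE natE (fun c => c.1.2) := (fst _ _).snd'
  have ht : CodeFP ctxE natE (fun c => c.2) := snd _ _
  have hN : CodeFP ctxE natE (fun c => nvars c.1.1.1) :=
    (natAdd.comp ((natMul.comp ((const _ 2).pair hn)).pair (const _ 1))).congr fun _ => rfl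
  have hi : CodeFP ctxE natE (fun c => c.2 / nvars c.1.1.1) := (natDiv.comp (ht.pair hN)).congr fun _ => rfl
  have hj : CodeFP ctxE natE (fun c => c.2 % nvars c.1.1.1) := (natMod.comp (ht.pair hN)).congr fun _ => rfl
  have h3n : CodeFP ctxE natE (fun c => 3 * c.1.1.1) := (natMul.comp ((const _ 3).pair hn)).congr fun _ => rfl
  have h2n : CodeFP ctxE natE (fun c => 2 * c.1.1.1) := (natMul.comp ((const _ 2).pair hn)).congr fun _ => rfl
  have hqlt : CodeFP ctxE bitE (fun c => decide (c.1.2 < 3 * c.1.1.1)) :=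
    (natLt.comp (hq.pair h3n)).congr fun _ => rfl
  have hqm : CodeFP ctxE natE (fun c => c.1.2 % 3) := (natMod.comp (hq.pair (const _ 3))).congr fun _ => rfl
  have hqd : CodeFP ctxE natE (fun c => c.1.2 / 3) := (natDiv.comp (hq.pair (const _ 3))).congr fun _ => rfl
  have hnqd : CodeFP ctxE natE (fun c => c.1.1.1 + c.1.2 / 3) := (natAdd.comp (hn.pair hqd)).congr fun _ => rfl
  have hp : CodeFP ctxE natE (fun c => c.1.2 - 3 * c.1.1.1) := (natSub.comp (hq.pair h3n)).congr fun _ => rfl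
  have hu : CodeFP ctxE natE (fun c => (c.1.2 - 3 * c.1.1.1) / c.1.1.1) :=
    (natDiv.comp (hp.pair hn)).congr fun _ => rfl
  have hw : CodeFP ctxE natE (fun c => (c.1.2 - 3 * c.1.1.1) % c.1.1.1) :=
    (natMod.comp (hp.pair hn)).congr fun _ => rfl
  have hnu : CodeFP ctxE natE (fun c => c.1.1.1 + (c.1.2 - 3 * c.1.1.1) / c.1.1.1) :=
    (natAdd.comp (hn.pair hu)).congr fun _ => rfl
  have hnw : CodeFP ctxE natE (fun c => c.1.1.1 + (c.1.2 - 3 * c.1.1.1) % c.1.1.1) :=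
    (natAdd.comp (hn.pair hw)).congr fun _ => rfl
  have hbit₁ : CodeFP ctxE bitE (fun c => c.1.1.2.getD
      ((c.1.2 - 3 * c.1.1.1) % c.1.1.1 + c.1.1.1 * ((c.1.2 - 3 * c.1.1.1) / c.1.1.1)) false) :=
    (strGetDNat.comp (hb.pair (natAdd.comp (hw.pair (natMul.comp (hn.pair hu)))))).congr fun _ => rfl
  have hbit₂ : CodeFP ctxE bitE (fun c => c.1.1.2.getD
      ((c.1.2 - 3 * c.1.1.1) / c.1.1.1 + c.1.1.1 * ((c.1.2 - 3 * c.1.1.1) % c.1.1.1)) false) :=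
    (strGetDNat.comp (hb.pair (natAdd.comp (hu.pair (natMul.comp (hn.pair hw)))))).congr fun _ => rfl
  -- indicator tests `[i = a ∧ j = b]`
  have ind : ∀ {ga gb : ((ℕ × List Bool) × ℕ) × ℕ → ℕ}, CodeFP ctxE natE ga → CodeFP ctxE natE gb →
      CodeFP ctxE bitE (fun c => decide (c.2 / nvars c.1.1.1 = ga c) && decide (c.2 % nvars c.1.1.1 = gb c)) :=
    fun hga hgb => ((natEq.comp (hi.pair hga)).and (natEq.comp (hj.pair hgb))).congr fun _ => rfl
  have c1 : CodeFP ctxE smE (fun _ => (1 : ℤ)) := const _ _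
  have c0 : CodeFP ctxE smE (fun _ => (0 : ℤ)) := const _ _
  have cm : CodeFP ctxE smE (fun _ => (-1 : ℤ)) := const _ _
  have V0 : CodeFP ctxE smE (fun c =>
      if decide (c.2 / nvars c.1.1.1 = c.1.2 / 3) && decide (c.2 % nvars c.1.1.1 = c.1.1.1 + c.1.2 / 3)
      then (1 : ℤ) else 0) := (ind hqd hnqd).ite c1 c0
  have V1 : CodeFP ctxE smE (fun c =>
      if decide (c.2 / nvars c.1.1.1 = c.1.2 / 3) && decide (c.2 % nvars c.1.1.1 = c.1.2 / 3) then (1 : ℤ)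
      else if decide (c.2 / nvars c.1.1.1 = c.1.2 / 3) && decide (c.2 % nvars c.1.1.1 = 2 * c.1.1.1)
        then -1 else 0) :=
    (ind hqd hqd).ite c1 ((ind hqd h2n).ite cm c0)
  have V2 : CodeFP ctxE smE (fun c =>
      if decide (c.2 / nvars c.1.1.1 = c.1.1.1 + c.1.2 / 3) &&
          decide (c.2 % nvars c.1.1.1 = c.1.1.1 + c.1.2 / 3) then (1 : ℤ)
      else if decide (c.2 / nvars c.1.1.1 = c.1.1.1 + c.1.2 / 3) && decide (c.2 % nvars c.1.1.1 = 2 * c.1.1.1)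
        then -1 else 0) :=
    (ind hnqd hnqd).ite c1 ((ind hnqd h2n).ite cm c0)
  have KILL : CodeFP ctxE smE (fun c =>
      if decide (c.2 / nvars c.1.1.1 = 2 * c.1.1.1) && decide (c.2 % nvars c.1.1.1 = 2 * c.1.1.1)
      then (1 : ℤ) else 0) := (ind h2n h2n).ite c1 c0
  have EDGE := (ind hu hu).ite c1 ((ind hnu hnu).ite c1 ((ind hw hw).ite c1 ((ind hnw hnw).ite c1
    ((ind hu hnw).ite cm ((ind hw hnu).ite cm ((ind h2n h2n).ite cm c0))))))
  have PAIR := hbit₁.ite (((natEq.comp (hu.pair hw)).or hbit₂.not).ite KILL EDGE) c0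
  have VERT := (natEq.comp (hqm.pair (const _ 0))).ite V0 ((natEq.comp (hqm.pair (const _ 1))).ite V1 V2)
  refine ((hqlt.ite VERT PAIR).congr fun c => ?_)
  rw [← entryB_eq]
  rfl

/-- The context of a form: `((n, bits), q)`. [cite: AroraBarak2009, §1.3] -/
abbrev fctxE : (ℕ × List Bool) × ℕ → List Bool := pairE (pairE natE strE) natE

/-- The unary budget on codes. [cite: AroraBarak2009, §1.3] -/
theorem budgetFP : CodeFP (pairE natE strE) (rawE unitE) (fun p => List.replicate (budget p.2) ()) :=
  ((unitsPow 3).comp (unSucc.comp (unSucc.comp (strLength.comp (snd _ _))))).congr fun _ => rfl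

/-- **One form on codes** (a bounded range of positions mapped through the entry table, then headed).
[cite: BlaserIkenmeyerLysikovPandeySchreyer2019, Thm. 33 (proof)] [cite: AroraBarak2009, §1.3] -/
theorem formFP : CodeFP fctxE (listE smE) (fun s => formCapped s.1.1 s.1.2 s.2) := by
  have hn : CodeFP fctxE natE (fun s => s.1.1) := (fst _ _).fst'
  have hN : CodeFP fctxE natE (fun s => nvars s.1.1) :=
    (natAdd.comp ((natMul.comp ((const _ 2).pair hn)).pair (const _ 1))).congr fun _ => rfl
  have hNN : CodeFP fctxE natE (fun s => nvars s.1.1 * nvars s.1.1) := (natMul.comp (hN.pair hN)).congr fun _ => rfl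
  have hB : CodeFP fctxE (rawE unitE) (fun s => List.replicate (budget s.1.2) ()) := budgetFP.comp (fst _ _)
  have hrange : CodeFP fctxE (rawE natE)
      (fun s => List.range (min (nvars s.1.1 * nvars s.1.1) (List.replicate (budget s.1.2) ()).length)) :=
    ((brange unitE).comp (hB.pair hNN)).congr fun _ => rfl
  exact ((listOfRaw smE).comp ((CodeFP.map entryFP).comp ((CodeFP.id fctxE).pair hrange))).congr fun _ => rfl

/-- **The capped instance on codes.** [cite: BlaserIkenmeyerLysikovPandeySchreyer2019, Thm. 33 (proof)] [cite: AroraBarak2009, §1.3] -/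
theorem instCappedFP : CodeFP (pairE natE strE) hqE instCapped := by
  have hn : CodeFP (pairE natE strE) natE (fun p => p.1) := fst _ _
  have hN : CodeFP (pairE natE strE) natE (fun p => nvars p.1) :=
    (natAdd.comp ((natMul.comp ((const _ 2).pair hn)).pair (const _ 1))).congr fun _ => rfl
  have hM : CodeFP (pairE natE strE) natE (fun p => 3 * p.1 + p.1 * p.1) :=
    (natAdd.comp ((natMul.comp ((const _ 3).pair hn)).pair (natMul.comp (hn.pair hn)))).congr fun _ => rfl
  have hrange : CodeFP (pairE natE strE) (rawE natE)
      (fun p => List.range (min (3 * p.1 + p.1 * p.1) (List.replicate (budget p.2) ()).length)) :=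
    ((brange unitE).comp (budgetFP.pair hM)).congr fun _ => rfl
  have hforms : CodeFP (pairE natE strE) (listE (listE smE))
      (fun p => (List.range (min (3 * p.1 + p.1 * p.1) (List.replicate (budget p.2) ()).length)).map
        (formCapped p.1 p.2)) :=
    ((listOfRaw (listE smE)).comp ((CodeFP.map formFP).comp ((CodeFP.id _).pair hrange))).congr fun _ => rfl
  exact (hN.pair hforms).congr fun _ => rfl

/-- **The code test on strings.** [cite: AroraBarak2009, §0.1] [cite: AroraBarak2009, §1.3] -/
theorem isGCodeFP : CodeFP strE bitE isGCode := by
  have hre : CodeFP (pairE natE strE) strE (fun p => boolPair (encodeNat p.1) p.2) :=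
    of_fn _root_.id (PolyTimeComputable.id _) fun _ => rfl
  have hhdr : CodeFP strE (pairE natE strE) hdrOf := codeFP_hdrBody.congr fun _ => rfl
  have hre' : CodeFP strE strE (fun w => boolPair (encodeNat (hdrOf w).1) (hdrOf w).2) :=
    (hre.comp hhdr).congr fun _ => rfl
  have hinj : Function.Injective strE := fun _ _ h => h
  have h1 : CodeFP strE bitE (fun w => decide (boolPair (encodeNat (hdrOf w).1) (hdrOf w).2 = w)) :=
    ((eq hinj).comp (hre'.pair (CodeFP.id strE))).congr fun _ => by rfl
  have h2 : CodeFP strE bitE (fun w => decide ((hdrOf w).2.length = (hdrOf w).1 * (hdrOf w).1)) :=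
    (natEq.comp (((natOfUn.comp strLength).comp hhdr.snd').pair
      (natMul.comp (hhdr.fst'.pair hhdr.fst')))).congr fun _ => by rfl
  exact (h1.and h2).congr fun _ => by rfl

/-- **The instance map `reduceG` is computed on codes by a polynomial-time string function.**
[cite: BlaserIkenmeyerLysikovPandeySchreyer2019, Thm. 33] [cite: AroraBarak2009, §1.3] -/
theorem reduceGFP : CodeFP strE hqE reduceG := by
  have hhdr : CodeFP strE (pairE natE strE) hdrOf := codeFP_hdrBody.congr fun _ => rfl
  refine ((isGCodeFP.ite (instCappedFP.comp hhdr) (const _ badInst)).congr fun w => ?_)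
  unfold reduceG
  by_cases h : isGCode w = true
  · rw [if_pos h, if_pos h]
    have hlen : (hdrOf w).2.length = (hdrOf w).1 * (hdrOf w).1 := by
      have h' := h
      unfold isGCode at h'
      simp only [Bool.and_eq_true, decide_eq_true_eq] at h'
      exact h'.2
    exact instCapped_eq hlen
  · rw [if_neg h, if_neg h]

end Machine

/-! ### §D. `THREECOL ≤ₚ HQuad` and the discharge -/

section Assembly

open Brick

variable (F : Type u) [Field F]

/-- Bits of a block of length `n²` by row-major position are `ChromaticNP.bitOf`. [folklore] -/
private theorem getD_eq_bitOf {n : ℕ} (b : List Bool) (h : b.length = n * n) (u w : Fin n) :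
    b.getD (w + n * u) false = ChromaticNP.bitOf b h u w := by
  unfold ChromaticNP.bitOf
  rw [List.getD_eq_getElem]
  · rfl

/-- The header of a graph code. [folklore] -/
private theorem hdrOf_encode (n : ℕ) (G : SimpleGraph (Fin n)) :
    hdrOf (encodingGraph.encode ⟨n, G⟩) = (n, (encodingGraphFin n).encode G) := by
  rw [encodingGraph_encode, hdrOf, fstF_boolPair, sndF_boolPair, bitsToNat_encodeNat]

/-- Graph codes pass the code test. [folklore] -/
private theorem isGCode_encode (n : ℕ) (G : SimpleGraph (Fin n)) : isGCode (encodingGraph.encode ⟨n, G⟩) = true := by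
  simp only [isGCode, hdrOf_encode, Bool.and_eq_true, decide_eq_true_eq]
  exact ⟨(encodingGraph_encode ⟨n, G⟩).symm, ChromaticNP.length_encodingGraphFin_encode G⟩

/-- **`reduceG` on a graph code is the instance of the graph, a yes-instance iff the graph is
3-colourable.** [cite: BlaserIkenmeyerLysikovPandeySchreyer2019, Thm. 33 (proof)] -/
theorem reduceG_encode_mem_iff (n : ℕ) (G : SimpleGraph (Fin n)) :
    reduceG (encodingGraph.encode ⟨n, G⟩) ∈ hquadSet F ↔ G.Colorable 3 := by
  rw [reduceG, if_pos (isGCode_encode n G), hdrOf_encode]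
  refine instOf_mem_iff _ G fun u w => ?_
  rw [getD_eq_bitOf _ (ChromaticNP.length_encodingGraphFin_encode G)]
  exact ChromaticNP.bitOf_encode G u w

/-- **A string whose image is a yes-instance is the code of a 3-colourable graph** (the killing
slots exclude non-symmetric / non-irreflexive bit matrices, the code test everything else).
[cite: BlaserIkenmeyerLysikovPandeySchreyer2019, Thm. 33 (proof)] -/
theorem mem_THREECOL_of_reduceG_mem {w : List Bool} (hw : reduceG w ∈ hquadSet F) : w ∈ THREECOL := by
  unfold reduceG at hw
  by_cases hc : isGCode w = true
  · rw [if_pos hc] at hw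
    have hc' := hc
    unfold isGCode at hc'
    simp only [Bool.and_eq_true, decide_eq_true_eq] at hc'
    obtain ⟨hpair, hlen⟩ := hc'
    set n := (hdrOf w).1
    set b := (hdrOf w).2
    -- no killing slot fires: the bit matrix is symmetric and irreflexive
    have hs : ∀ i j, ChromaticNP.bitOf b hlen i j = true → ChromaticNP.bitOf b hlen j i = true := by
      intro i j hij
      rw [← getD_eq_bitOf] at hij ⊢
      by_contra hji
      exact instOf_not_mem_of_kill (F := F) n b i.2 j.2 hij (Or.inr (by simpa using hji)) hw
    have hi : ∀ i, ¬ ChromaticNP.bitOf b hlen i i = true := by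
      intro i hii
      rw [← getD_eq_bitOf] at hii
      exact instOf_not_mem_of_kill (F := F) n b i.2 i.2 hii (Or.inl rfl) hw
    set G := ChromaticNP.graphOfBits (ChromaticNP.bitOf b hlen)
    have hG : (encodingGraphFin n).encode G = b := ChromaticNP.encode_graphOfBits hlen hs hi
    have hcol : G.Colorable 3 := by
      refine (instOf_mem_iff (F := F) b G fun u v => ?_).1 hw
      rw [getD_eq_bitOf b hlen, ChromaticNP.graphOfBits_adj hs hi]
    refine ⟨⟨n, G⟩, hcol, ?_⟩
    rw [encodingGraph_encode, hG]
    exact hpair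
  · rw [if_neg hc] at hw
    exact absurd hw (badInst_not_mem F)

/-- **`THREECOL ≤ₚ HQuad_{{0,1,−1},F}`** (the Karp map of Thm 33, on codes, every field).
[cite: BlaserIkenmeyerLysikovPandeySchreyer2019, Thm. 33] -/
theorem THREECOL_karpReducible_hquadLanguage : THREECOL ≤ₚ hquadLanguage F := by
  obtain ⟨f, hf, hfr⟩ := reduceGFP
  refine ⟨f, hf, fun w => ?_⟩
  have hfw : f w = hquadInstEncoding.encode (reduceG w) := by rw [hqE_eq]; exact hfr w
  show w ∈ THREECOL ↔ f w ∈ hquadLanguage F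
  rw [hfw, hquadLanguage_eq, Encoding.mem_toLanguage_iff]
  constructor
  · rintro ⟨⟨n, G⟩, hG, rfl⟩
    exact (reduceG_encode_mem_iff F n G).2 hG
  · exact mem_THREECOL_of_reduceG_mem F

end Assembly

end BILPS19HQuad

section Discharge

variable (F : Type u) [Field F]

/-- **Discharge of `BILPS2019_thm33`** (BILPS Thm 33: "`HQuad_{{0,1,−1}, F}` is NP-hard for any field
`F`"): GRAPH 3-COLOURABILITY is NP-hard (`THREECOL_isNPHard`, Garey–Johnson GT4) and reduces to
`hquadLanguage F` by the printed system of quadratic forms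
(`BILPS19HQuad.THREECOL_karpReducible_hquadLanguage`), hardness propagating along `≤ₚ`
(`IsHard.of_reducible_holds`); every field `F`. [cite: BlaserIkenmeyerLysikovPandeySchreyer2019, Thm. 33] -/
theorem BILPS2019_thm33_holds : BILPS2019_thm33 F :=
  IsHard.of_reducible_holds ThreeColouring.THREECOL_isNPHard
    (BILPS19HQuad.THREECOL_karpReducible_hquadLanguage F)

end Discharge

/-! ### §G. `HQuad_{ℤ,F}` (arbitrary integer coefficients) is NP-hard by the same map, every field -/

namespace BILPS19HQuad

section General

variable (F : Type u) [Field F]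

/-- A string is the code of a 3-colourable graph iff its image under `reduceG` is a yes-instance of
`HQuad_{{0,1,−1},F}`. [cite: BlaserIkenmeyerLysikovPandeySchreyer2019, Thm. 33 (proof)] -/
theorem mem_THREECOL_iff_reduceG_mem (w : List Bool) : w ∈ THREECOL ↔ reduceG w ∈ hquadSet F := by
  constructor
  · rintro ⟨⟨n, G⟩, hG, rfl⟩
    exact (reduceG_encode_mem_iff F n G).2 hG
  · exact mem_THREECOL_of_reduceG_mem F

/-- The images of `reduceG` have `{0, ±1}` coefficients (or are the non-member `(0, [])`, whose `F⁰`
has no nonzero vector), so their membership in `HQuad_{ℤ,F}` is their membership in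
`HQuad_{{0,1,−1},F}`. [cite: BlaserIkenmeyerLysikovPandeySchreyer2019, Problem 4 (coefficients from `S`)] -/
theorem reduceG_mem_hquadZ_iff (w : List Bool) :
    reduceG w ∈ {x : ℕ × List (List ℤ) | (∀ l ∈ x.2, l.length = x.1 ^ 2) ∧
      ∃ v : Fin x.1 → F, v ≠ 0 ∧ ∀ l ∈ x.2, quadFormOfList F x.1 l v = 0} ↔ reduceG w ∈ hquadSet F := by
  unfold reduceG
  by_cases hc : isGCode w = true
  · rw [if_pos hc]
    simp only [hquadSet, instOf, Set.mem_setOf_eq, List.forall_mem_map, List.mem_range]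
    exact ⟨fun h => ⟨fun q _ => formOf_wellFormed _ _ q, h.2⟩, fun h => ⟨fun q _ => (formOf_wellFormed _ _ q).1, h.2⟩⟩
  · rw [if_neg hc]
    exact iff_of_false (fun h => by
      obtain ⟨v, hv, -⟩ := h.2
      exact hv (funext fun i => i.elim0)) (badInst_not_mem F)

/-- **`THREECOL ≤ₚ HQuad_{ℤ,F}`** (the Karp map of Thm 33 read with integer coefficients: Problem 4
with `S ⊇ {0, ±1}`), every field. [cite: BlaserIkenmeyerLysikovPandeySchreyer2019, Thm. 33 and Problem 4] -/
theorem THREECOL_karpReducible_hquadZLanguage : THREECOL ≤ₚ hquadZLanguage F := by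
  obtain ⟨f, hf, hfr⟩ := reduceGFP
  refine ⟨f, hf, fun w => ?_⟩
  have hfw : f w = hquadInstEncoding.encode (reduceG w) := by rw [hqE_eq]; exact hfr w
  show w ∈ THREECOL ↔ f w ∈ hquadZLanguage F
  rw [hfw]
  unfold hquadZLanguage
  rw [Encoding.mem_toLanguage_iff, reduceG_mem_hquadZ_iff F w, mem_THREECOL_iff_reduceG_mem F w]

end General

end BILPS19HQuad

section DischargeGeneral

variable (F : Type u) [Field F]

/-- **`HQuad_{ℤ,F}` is NP-hard, every field** — Thm 33's system has coefficients in `{0, ±1} ⊆ K`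
for every effective subfield `K` ("`HQuad_{S,F}`: a set of quadratic forms with coefficients from `S`",
Problem 4; the monotonicity in `S` used when Cor 35 is deduced from Thms 33–34 for `HMinRank1_{K,F}`),
here for the tree's integer-coefficient language `hquadZLanguage F` (the coefficient domain of the
typed Thm 34). [cite: BlaserIkenmeyerLysikovPandeySchreyer2019, Thm. 33, Problem 4 and Cor. 35 (proof)] -/
theorem BILPS2019_hquadZ_isNPHard : IsNPHard (hquadZLanguage F) :=
  IsHard.of_reducible_holds ThreeColouring.THREECOL_isNPHard
    (BILPS19HQuad.THREECOL_karpReducible_hquadZLanguage F)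

end DischargeGeneral

end Literature.Barriers.ValiantsHypothesis
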